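import Mathlib
import Summits.ValiantsHypothesis.ValiantsHypothesis.Theorems.LacunarySymmetroidMatrixDescartesDetLorentzianNonneg
import Summits.ValiantsHypothesis.ValiantsHypothesis.Theorems.LacunarySymmetroidMatrixDescartesDetLorentzianPolymatroidExchange
import Summits.ValiantsHypothesis.ValiantsHypothesis.Theorems.LacunarySymmetroidMatrixDescartesDetLorentzianRankNecessity
import Summits.ValiantsHypothesis.ValiantsHypothesis.Theorems.LacunarySymmetroidMatrixDescartesDetLorentzianRado
import HarnessLib

/-!
# Crux `MatrixDescartes` (stmt-ValiantsHypothesis-18050, the summit's V1), line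
# `Cruxes/MatrixDescartes/Lines/lorentzian_shadow.lean`, toward the KNOWN stub `stub_detLorentzian` —
# [M4] CLAUSE (c): the support of `det Σ_l X_l A_l` (`A_l ⪰ 0`) is an M-CONVEX SET

HONEST FRAMING.  Helper (`--supports stmt-ValiantsHypothesis-18050 --as helper`; merged desk, CLAIM-FIRST #4 of
val-lit-p7 g10, 2026-08-28) on a registered ALTERNATIVE line of V1; 0 definitions / 0 named facts.  This file
COMPLETES clause (c) of `IsLorentzianArray m K (detArray m K A)` for PSD families; with (a) and (b)
(`…DetLorentzianNonneg.lean`) the only open clause of `stub_detLorentzian : DetLorentzian` is (d), the Hessian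
signature condition ("at most one positive eigenvalue" of every `(m−2)`-nd partial Hessian — Gårding /
Brändén–Huh, not attempted here).  `stub_detLorentzian`, the law stubs `stub_lorentzianDescartes` / `stub_bmd`,
the crux `MatrixDescartes`, Conjecture B and `VP ≠ VNP` are all OPEN; nothing here bears on them.

* `type_apply_eq_card` — the colour type of an injective row selection depends only on its image.
* **`coeff_det_pencil_ne_zero_of_rank`** — SUFFICIENCY (Panov via Rado): `Σ α = m` and
  `Σ_{l∈S} α_l ≤ rank (Σ_{l∈S} A_l)` for all `S` ⇒ the coefficient of `s^α` is non-zero: Rado's theorem [M3]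
  (`rado_linearIndependent_transversal`) on the colour blocks of the stacked Gram factor, requested `α_l` times
  each (a colouring `c : Fin m → Fin K` with fibres `α` from `finSigmaFinEquiv`), gives `m` independent rows of
  type `α`; sorted (`Finset.orderEmbOfFin`) they are a non-vanishing Cauchy–Binet square (`det_pencil_eq_sum_sq`).
* **`detArray_support_isMConvexOn`** — CLAUSE (c) in the line's currency, `IsMConvexOn ((layer m K).filter
  (detArray m K A · ≠ 0)) (fun _ => 0)` UNFOLDED (checked to close the line's statement by `exact` against verbatim
  copies of `layer/exch/IsMConvexOn/detArray`): support = lattice points of the base polytope of the submodular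
  rank function ([M2] `sum_le_rank_of_detArray_ne_zero`, `rank_sum_submodular` + sufficiency above), and those are
  M-convex ([M1] `polymatroid_isMConvex`).
[Brändén–Huh, Lorentzian polynomials, Ann. Math. 192 (2020) §2; Panov 1987; Rado 1942; Murota 2003 §4.4; folklore]
-/

set_option linter.dupNamespace false
set_option autoImplicit false

noncomputable section

namespace Summit.ValiantsHypothesis.ValiantsHypothesis.Theorems.LacunarySymmetroidMatrixDescartes

namespace DetLorentzian

open Matrix Finset MvPolynomial

/-- The colour type of an injective row selection only depends on its image. [folklore] -/
theorem type_apply_eq_card {m K : ℕ} (u : Fin m → Fin (K * m)) (hu : Function.Injective u) (l : Fin K) :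
    (∑ i, Finsupp.single (finProdFinEquiv.symm (u i)).1 (1 : ℕ)) l =
      ((univ.image u).filter (fun r => (finProdFinEquiv.symm r).1 = l)).card := by
  classical
  rw [Finsupp.finsetSum_apply, Finset.filter_image, Finset.card_image_of_injective _ hu, Finset.card_filter]
  refine Finset.sum_congr rfl fun i _ => ?_
  simp only [Finsupp.single_apply]

/-- **Sufficiency (Rado): a lattice point of the rank polymatroid is a support point.**  If `Σ α = m` and
`Σ_{l∈S} α_l ≤ rank (Σ_{l∈S} A_l)` for all `S` (`A_l ⪰ 0`), then the coefficient of `s^α` in `det Σ_l s_l A_l`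
is non-zero: Rado's theorem applied to the colour blocks of the stacked Gram factor (block `l` requested `α_l`
times) gives `m` independent rows of colour type `α`, i.e. a non-vanishing Cauchy–Binet square.
[Panov 1987 (criterion for mixed discriminants), via Rado 1942; folklore] -/
theorem coeff_det_pencil_ne_zero_of_rank {m K : ℕ} (A : Fin K → Matrix (Fin m) (Fin m) ℝ)
    (hA : ∀ l, (A l).PosSemidef) (α : Fin K → ℕ) (hsum : ∑ l, α l = m)
    (hrank : ∀ S : Finset (Fin K), ∑ l ∈ S, α l ≤ (∑ l ∈ S, A l).rank) :
    coeff (Finsupp.equivFunOnFinite.symm α)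
      (Matrix.det (∑ l, (X l : MvPolynomial (Fin K) ℝ) • (A l).map C)) ≠ 0 := by
  classical
  obtain ⟨B, Bst, hB, hBst, hGram⟩ := exists_gram_blocks A hA
  -- a colouring `c : Fin m → Fin K` with fibre sizes `α`
  let σ : Fin m ≃ (Σ l : Fin K, Fin (α l)) := (finCongr hsum.symm).trans finSigmaFinEquiv.symm
  let c : Fin m → Fin K := fun i => (σ i).1
  have hc : ∀ l, (univ.filter (fun i => c i = l)).card = α l := by
    intro l
    rw [← Finset.card_map σ.toEmbedding]
    have : (univ.filter (fun i => c i = l)).map σ.toEmbedding =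
        (univ : Finset (Σ l : Fin K, Fin (α l))).filter (fun p => p.1 = l) := by
      ext p
      simp only [Finset.mem_map, Finset.mem_filter, Finset.mem_univ, true_and, Equiv.toEmbedding_apply]
      constructor
      · rintro ⟨i, hi, rfl⟩; exact hi
      · intro hp; exact ⟨σ.symm p, by simp [c, hp], by simp⟩
    rw [this]
    have h2 : (univ : Finset (Σ l : Fin K, Fin (α l))).filter (fun p => p.1 = l) =
        (univ : Finset (Fin (α l))).map (Function.Embedding.sigmaMk l) := by
      ext ⟨l', x⟩
      simp only [Finset.mem_filter, Finset.mem_univ, true_and, Finset.mem_map, Function.Embedding.sigmaMk_apply]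
      constructor
      · rintro rfl; exact ⟨x, rfl⟩
      · rintro ⟨y, h⟩; exact (congrArg Sigma.fst h).symm
    rw [h2, Finset.card_map, Finset.card_univ, Fintype.card_fin]
  -- Rado's condition for the blocks `E i = {rows of colour c i}`
  let E : Fin m → Finset (Fin (K * m)) := fun i => univ.filter (fun r => (finProdFinEquiv.symm r).1 = c i)
  have hW : ∀ S : Finset (Fin K), (∑ l ∈ S, A l).rank =
      Module.finrank ℝ (Submodule.span ℝ ((fun r : Fin (K * m) => Bst r) ''
        {r | (finProdFinEquiv.symm r).1 ∈ S})) := by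
    intro S
    rw [hGram S, Matrix.rank_transpose_mul_self, Matrix.rank_eq_finrank_span_row, Set.image_eq_range]
    rfl
  have hRado : ∀ J : Finset (Fin m), J.card ≤
      Module.finrank ℝ (Submodule.span ℝ ((fun r : Fin (K * m) => Bst r) '' ((J.biUnion E : Finset _) : Set _))) := by
    intro J
    have hset : ((J.biUnion E : Finset (Fin (K * m))) : Set (Fin (K * m))) =
        {r | (finProdFinEquiv.symm r).1 ∈ J.image c} := by
      ext r
      simp only [Finset.coe_biUnion, Finset.mem_coe, Set.mem_iUnion, Set.mem_setOf_eq, Finset.mem_image, E,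
        Finset.mem_filter, Finset.mem_univ, true_and, exists_prop]
      constructor
      · rintro ⟨i, hi, h⟩; exact ⟨i, hi, h.symm⟩
      · rintro ⟨i, hi, h⟩; exact ⟨i, hi, h.symm⟩
    rw [hset, ← hW]
    refine le_trans ?_ (hrank (J.image c))
    -- `|J| = Σ_{l ∈ c(J)} |J ∩ c⁻¹ l| ≤ Σ_{l ∈ c(J)} α l`
    rw [Finset.card_eq_sum_card_image c J]
    refine Finset.sum_le_sum fun l _ => ?_
    rw [← hc l]
    exact Finset.card_le_card (Finset.monotone_filter_left _ (Finset.subset_univ J))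
  obtain ⟨g, hgE, hli⟩ := rado_linearIndependent_transversal (𝕜 := ℝ) (fun r : Fin (K * m) => Bst r) E hRado
  have hginj : Function.Injective g := Function.Injective.of_comp hli.injective
  have hgc : ∀ i, (finProdFinEquiv.symm (g i)).1 = c i := fun i => by
    have := hgE i
    simpa [E] using this
  -- sort the selected rows
  set s : Finset (Fin (K * m)) := univ.image g with hs
  have hscard : s.card = m := by
    rw [hs, Finset.card_image_of_injective _ hginj, Finset.card_univ, Fintype.card_fin]
  let t : Fin m → Fin (K * m) := fun i => s.orderEmbOfFin hscard i
  have htmono : StrictMono t := (s.orderEmbOfFin hscard).strictMono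
  have htrange : Set.range t = Set.range g := by
    have h1 : Set.range t = (s : Set (Fin (K * m))) := Finset.range_orderEmbOfFin s hscard
    rw [h1, hs, Finset.coe_image, Finset.coe_univ, Set.image_univ]
  -- the sorted selection has independent rows, hence a non-zero minor
  have hlit : LinearIndependent ℝ (fun i => (Bst.submatrix t id) i) := by
    have hrg : Set.range (fun i => (Bst.submatrix t id) i) = Set.range ((fun r => Bst r) ∘ g) := by
      have e1 : (fun i => (Bst.submatrix t id) i) = (fun r => Bst r) ∘ t := by
        funext i; rfl
      rw [e1, Set.range_comp, Set.range_comp, htrange]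
    rw [linearIndependent_iff_card_eq_finrank_span, Fintype.card_fin, Set.finrank, hrg]
    have := linearIndependent_iff_card_eq_finrank_span.1 hli
    rw [Fintype.card_fin, Set.finrank] at this
    exact this
  have hdet : (Bst.submatrix t id).det ≠ 0 := by
    have hU : IsUnit (Bst.submatrix t id) := (Matrix.linearIndependent_rows_iff_isUnit).1 hlit
    exact ((Matrix.isUnit_iff_isUnit_det _).1 hU).ne_zero
  -- its colour type is `α`
  have htype : (∑ i, Finsupp.single (finProdFinEquiv.symm (t i)).1 (1 : ℕ)) =
      Finsupp.equivFunOnFinite.symm α := by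
    ext l
    rw [type_apply_eq_card t htmono.injective, Finsupp.coe_equivFunOnFinite_symm]
    have himg : univ.image t = univ.image g := by
      rw [← Finset.coe_inj, Finset.coe_image, Finset.coe_image, Finset.coe_univ, Set.image_univ,
        Set.image_univ, htrange]
    rw [himg, ← type_apply_eq_card g hginj, Finsupp.finsetSum_apply]
    simp only [Finsupp.single_apply, hgc]
    rw [← Finset.card_filter]
    exact hc l
  -- the Cauchy–Binet square of `t` carries the coefficient
  rw [det_pencil_eq_sum_sq A B hB Bst hBst, coeff_sum]
  have hle : coeff (Finsupp.equivFunOnFinite.symm α)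
      (C ((Bst.submatrix t id).det * (Bst.submatrix t id).det) *
        ∏ i, (X (finProdFinEquiv.symm (t i)).1 : MvPolynomial (Fin K) ℝ)) ≤
      ∑ t' ∈ (univ : Finset (Fin m → Fin (K * m))).filter (fun t => StrictMono t),
        coeff (Finsupp.equivFunOnFinite.symm α)
          (C ((Bst.submatrix t' id).det * (Bst.submatrix t' id).det) *
            ∏ i, (X (finProdFinEquiv.symm (t' i)).1 : MvPolynomial (Fin K) ℝ)) :=
    Finset.single_le_sum (f := fun t' => coeff (Finsupp.equivFunOnFinite.symm α)
          (C ((Bst.submatrix t' id).det * (Bst.submatrix t' id).det) *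
            ∏ i, (X (finProdFinEquiv.symm (t' i)).1 : MvPolynomial (Fin K) ℝ)))
      (fun t' _ => coeff_C_mul_self_mul_prod_X_nonneg _ _ _) (Finset.mem_filter.2 ⟨Finset.mem_univ _, htmono⟩)
  have hpos : 0 < coeff (Finsupp.equivFunOnFinite.symm α)
      (C ((Bst.submatrix t id).det * (Bst.submatrix t id).det) *
        ∏ i, (X (finProdFinEquiv.symm (t i)).1 : MvPolynomial (Fin K) ℝ)) := by
    rw [prod_X_eq_monomial, coeff_C_mul, coeff_monomial, if_pos htype, mul_one]
    exact mul_self_pos.2 hdet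
  exact ne_of_gt (hpos.trans_le hle)


/-- **Clause (c) of `IsLorentzianArray m K (detArray m K A)` for `A_l ⪰ 0` — the support of the coefficient
array of `det Σ_l X_l A_l` is an M-CONVEX SET**, in the line's currency: `IsMConvexOn ((layer m K).filter
(fun α => detArray m K A α ≠ 0)) (fun _ => 0)` with `layer`, `detArray`, `exch`, `IsMConvexOn` UNFOLDED (the line
file `Cruxes/MatrixDescartes/Lines/lorentzian_shadow.lean` carries `sorry`s and is not importable; the statements
agree definitionally).  Proof: the support is the set of lattice points of the base polytope of the submodular
rank function `S ↦ rank (Σ_{l∈S} A_l)` (necessity `sum_le_rank_of_detArray_ne_zero` [M2], sufficiency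
`coeff_det_pencil_ne_zero_of_rank` via Rado [M3]), and such point sets are M-convex (`polymatroid_isMConvex` [M1]).
With (a) `detArray_nonneg_of_posSemidef` and (b) `detArray_eq_zero_of_not_mem_layer` this leaves clause (d)
(the Hessian / Lorentzian signature condition, Brändén–Huh) as the ONLY open part of `stub_detLorentzian`.
[Brändén–Huh 2020 §2 (supports of Lorentzian polynomials are M-convex) for this determinantal case; Panov 1987;
Murota 2003 §4.4; folklore] -/
theorem detArray_support_isMConvexOn (m K : ℕ) (A : Fin K → Matrix (Fin m) (Fin m) ℝ)
    (hA : ∀ l, (A l).PosSemidef) :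
    ∀ α ∈ (((Fintype.piFinset fun _ : Fin K => Finset.range (m + 1)).filter (fun α => ∑ i, α i = m)).filter
        (fun α => MvPolynomial.coeff (Finsupp.equivFunOnFinite.symm α)
          (Matrix.det (∑ l, (MvPolynomial.X l : MvPolynomial (Fin K) ℝ) • (A l).map MvPolynomial.C)) ≠ 0)),
    ∀ β ∈ (((Fintype.piFinset fun _ : Fin K => Finset.range (m + 1)).filter (fun α => ∑ i, α i = m)).filter
        (fun α => MvPolynomial.coeff (Finsupp.equivFunOnFinite.symm α)
          (Matrix.det (∑ l, (MvPolynomial.X l : MvPolynomial (Fin K) ℝ) • (A l).map MvPolynomial.C)) ≠ 0)),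
    ∀ i : Fin K, β i < α i →
      ∃ j : Fin K, α j < β j ∧
        (α - Pi.single i 1 + Pi.single j 1) ∈ (((Fintype.piFinset fun _ : Fin K => Finset.range (m + 1)).filter (fun α => ∑ i, α i = m)).filter
        (fun α => MvPolynomial.coeff (Finsupp.equivFunOnFinite.symm α)
          (Matrix.det (∑ l, (MvPolynomial.X l : MvPolynomial (Fin K) ℝ) • (A l).map MvPolynomial.C)) ≠ 0)) ∧
        (β - Pi.single j 1 + Pi.single i 1) ∈ (((Fintype.piFinset fun _ : Fin K => Finset.range (m + 1)).filter (fun α => ∑ i, α i = m)).filter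
        (fun α => MvPolynomial.coeff (Finsupp.equivFunOnFinite.symm α)
          (Matrix.det (∑ l, (MvPolynomial.X l : MvPolynomial (Fin K) ℝ) • (A l).map MvPolynomial.C)) ≠ 0)) ∧
        (fun _ : Fin K → ℕ => (0 : ℚ)) (α - Pi.single i 1 + Pi.single j 1) +
            (fun _ : Fin K → ℕ => (0 : ℚ)) (β - Pi.single j 1 + Pi.single i 1) ≤
          (fun _ : Fin K → ℕ => (0 : ℚ)) α + (fun _ : Fin K → ℕ => (0 : ℚ)) β := by
  intro α hα β hβ i hi
  -- the rank function and its base polytope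
  set f : Finset (Fin K) → ℕ := fun S => (∑ l ∈ S, A l).rank with hf
  have hsub : ∀ S T, f (S ∪ T) + f (S ∩ T) ≤ f S + f T := fun S T => rank_sum_submodular A hA S T
  have h0 : f ∅ = 0 := by
    simp only [hf, Finset.sum_empty, Matrix.rank_zero]
  -- a support point forces full rank: `f univ = m`
  have hα' := Finset.mem_filter.1 hα
  have hαsum : ∑ l, α l = m := (Finset.mem_filter.1 hα'.1).2
  have hm : f univ = m := by
    apply le_antisymm
    · simpa [hf] using Matrix.rank_le_width (∑ l ∈ (univ : Finset (Fin K)), A l)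
    · have h := sum_le_rank_of_detArray_ne_zero m K A hA α hα'.2 univ
      rw [hαsum] at h
      exact h
  have hD : ∀ γ : Fin K → ℕ, γ ∈ (((Fintype.piFinset fun _ : Fin K => Finset.range (m + 1)).filter (fun α => ∑ i, α i = m)).filter
        (fun α => MvPolynomial.coeff (Finsupp.equivFunOnFinite.symm α)
          (Matrix.det (∑ l, (MvPolynomial.X l : MvPolynomial (Fin K) ℝ) • (A l).map MvPolynomial.C)) ≠ 0)) ↔
      (∀ S, ∑ l ∈ S, γ l ≤ f S) ∧ ∑ l, γ l = f univ := by
    intro γ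
    constructor
    · intro hγ
      have hγ' := Finset.mem_filter.1 hγ
      have hγsum : ∑ l, γ l = m := (Finset.mem_filter.1 hγ'.1).2
      exact ⟨fun S => sum_le_rank_of_detArray_ne_zero m K A hA γ hγ'.2 S, hγsum.trans hm.symm⟩
    · rintro ⟨hS, hγsum⟩
      rw [hm] at hγsum
      refine Finset.mem_filter.2 ⟨Finset.mem_filter.2 ⟨?_, hγsum⟩,
        coeff_det_pencil_ne_zero_of_rank A hA γ hγsum hS⟩
      refine Fintype.mem_piFinset.2 fun l => Finset.mem_range.2 (Nat.lt_succ_of_le ?_)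
      rw [← hγsum]
      exact Finset.single_le_sum (fun k _ => Nat.zero_le (γ k)) (Finset.mem_univ l)
  obtain ⟨j, hj, h1, h2⟩ := polymatroid_isMConvex f hsub h0 _ hD α hα β hβ i hi
  exact ⟨j, hj, h1, h2, by simp⟩

end DetLorentzian

end Summit.ValiantsHypothesis.ValiantsHypothesis.Theorems.LacunarySymmetroidMatrixDescartes

end
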